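import Summits.BirchSwinnertonDyer.BirchSwinnertonDyer.Theorems.AlignedTransportAtTwoMainConjectureTransportAlignedAtTwoDeltaPosJacobian
import HarnessLib

/-!
# Crux C1 `MainConjectureTransportAlignedAtTwo` (stmt-BirchSwinnertonDyer-22296), line `birth`, plan «deltapos-galois» step (G4, Galois half):
# THE GALOIS PLANE AT A DEPLETED LEVEL, CARRIER-AGNOSTIC — two abstract `ℚ`-rational parametrisation maps `Φᵢ : J₀(L) → Wᵢ(ℂ)` of an `S₃` pair
# sharing a cubic field transport half-classes `[x/2] ∈ J₀(L)[2]` to `2`-torsion points that DIFFER BY THE equivariant isomorphism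
# (width seat att-p3 g14; `--supports 22296`)

THEOREMS ONLY (no `def`, no named fact, no `sorry`). CONDITIONAL on the PRINT Hecke pair `hSD`, `hBz` (as hypotheses) and on abstract Galois data
(hypotheses `gal`, `hgal₁`, `hgal₂` below). BSD is not proved by this; C1 is not closed by this.

Why (`Cruxes/MainConjectureTransportAlignedAtTwo/Lines/birth-deltapos-galois-plan.md` (G4); lead att-p1 g10 HANDOFF «general conductors: + T2»; att-p4 g13
memo `DELTA-POS-ENGINE-att-p4-g13.md` §3(b)). The lead's `…DeltaPosJacobian.jacobiMap_half_transport` (p667761) is the Galois step (G1) at the CONDUCTOR level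
`N` for two genuine parametrisation data `Dᵢ : ModularParametrizationData Wᵢ N` (equal conductors) and the carrier `J : ModularJacobianGaloisData N ι`.
For UNEQUAL conductors the engine (`…DeltaPosEngine`, att-p4 g13) and the mod-`2` functional (`…DeltaPosFunctionalDepleted`) live at a depleted level
`L = N₁N₂·∏_{ℓ∈S}ℓ²` with the maps `[x] ↦ uᵢ(cᵢ·D_S·x(gᵢ))`, `gᵢ` the `S`-depleted forms — whose `Γ_ℚ`-equivariance is a typing ask (T2 / T1⁺, not yet in
the tree). This file runs the lead's argument at such a level `L` for ABSTRACT additive maps `Φᵢ : J0 L →+ Wᵢ(ℂ)` and an ABSTRACT Galois action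
`gal σ : J0.tors L →+ J0.tors L`, assuming exactly the equivariance clause a carrier would provide (`hgalᵢ`, the shape of
`ModularJacobianGaloisData.jacobiMap_galAct`) plus the Hecke-kernel relations of the `Φᵢ` on half-classes (`hTᵢ`, `hUᵢ` — for `[x] ↦ u(c'·x(g))` these are
the eigen-relations `T_q g = a_q g` (`q ∤ L`), `U_q g = 0` (`q ∣ L`) of the depleted eigenform and the `a_q`-parity congruence) and their non-vanishing
on some half-class (`hnzᵢ`, from `μ = 0`):

* **`half_transport_of_abstract`** — with the (K4) inputs of att-p4 g11's `…BuzzardKFour.fourCosets_of_dvd_S3` for `W₁` (globally minimal, no rational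
  `2`-torsion abscissa, `Δ(W₁) ∉ ℚ₂²` = off the Kilford stratum, newform `f₁` of level `N₁`, `L` odd, `N₁·∏_{S}ℓ² ∣ L`, `primes(L) ⊆ S`, good reduction
  off `2L`) and the shared cubic field (`[F:ℚ] = 3`, roots `r₁ r₂`, `Δ(W₂) ∉ ℚ²`): for every `x ∈ Λ_L = H₁(X₀(L);ℤ)` and `P₁ ∈ W₁[2](ℚ̄)` with
  `Φ₁ [x/2] = ι P₁`, **`Φ₂ [x/2] = ι (e P₁)`** for THE `Γ_ℚ`-equivariant `e : W₁[2] ≃+ W₂[2]`.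
  Proof = the lead's, verbatim in structure: `θᵢ : Λ_L → Wᵢ[2]` through `…DeltaPosJacobian.existsUnique_geomTorsion_eq`, a common lifted action on
  `Λ_L` (`exists_half_eq`), equivariance from `hgalᵢ`, the common kernel `K ⊇ 2Λ + Σ_{q∤L}(T_q^∨ − a_q(W₁))Λ + Σ_{q∣L} U_q^∨Λ` of index `≤ 4`
  (`fourCosets_of_dvd_S3`, `index_addSubgroupOf_le_four`), and `…DeltaPosGaloisPlane.comp_eq_of_sharedCubicField`.
* `half_transport_link` — the same conclusion packaged as the `hlink` hypothesis of `…DeltaPosParityLinkDepleted.even_depletedPlusValue_iff_of_link`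
  when `Φᵢ [x/2] = uᵢ(cᵢ·D_S·x(gᵢ)/2)` (hypotheses `hΦ₁ hΦ₂`): `∃ P, ι P = u₁(c₁·D_S·x(g₁)/2) ∧ ι (e P) = u₂(c₂·D_S·x(g₂)/2)`.

So (G4) = a carrier instance (T2/T1⁺) + this file + `…DeltaPosParityLinkDepleted` + `…DeltaPosEngine.lamLaw_of_depleted_periodFunctionals_congr`.
The lead's conductor-level theorem is the special case `L = N`, `S = primes(N)`… no: it is the case `Φᵢ = Dᵢ.jacobiMap`, `gal = J.galAct` of the
present statement read with `…DeltaPosFourCosets` instead of `…BuzzardKFour` (both are kept; nothing is restated).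

References: Darmon–Diamond–Taylor 1995 §1.3, §1.5, §1.7 [DarmonDiamondTaylor1995]; Buzzard 2000 Prop. 2.4 [Buzzard2000LevelLoweringModTwo];
Atkin–Lehner 1970 §3 [AtkinLehner1970]; Silverman AEC III.§7 [SilvermanAEC2009].
-/

noncomputable section

-- justification: the `Summit.BirchSwinnertonDyer.BirchSwinnertonDyer.…` path repeats a component (route-file convention)
set_option linter.dupNamespace false
set_option autoImplicit false

open scoped MatrixGroups ModularForm NumberField Classical
open CongruenceSubgroup Complex WeierstrassCurve IsDedekindDomain Polynomial Module
open Literature.NumberTheory.EllipticCurves Literature.NumberTheory.EllipticCurves.ModularForms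
open Literature.NumberTheory.EllipticCurves.Greenberg1999
open Literature.NumberTheory.EllipticCurves.DokchitserDokchitser2012
open Rat.HeightOneSpectrum
open Summit.BirchSwinnertonDyer.Rank1Residual.F1Sign2
open Summit.BirchSwinnertonDyer.BirchSwinnertonDyer.Theorems.AlignedTransportAtTwoDeltaPosGaloisPlane
open Summit.BirchSwinnertonDyer.BirchSwinnertonDyer.Theorems.AlignedTransportAtTwoBuzzardKFour
open Summit.BirchSwinnertonDyer.BirchSwinnertonDyer.Theorems.AlignedTransportAtTwoDeltaPosJacobian

namespace Summit.BirchSwinnertonDyer.BirchSwinnertonDyer.Theorems.AlignedTransportAtTwoDeltaPosJacobianLevel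

section Transport

variable {L : ℕ} [NeZero L] (ι : AlgebraicClosure ℚ →+* ℂ)

/-- An additive map on `J₀(L)` sends a half-class `[x/2]`, `x ∈ Λ_L`, to a point killed by doubling. [folklore] -/
theorem apply_half_add_self {B : Type*} [AddCommGroup B] (Φ : J0 L →+ B)
    {x : Module.Dual ℂ (CuspForm (Gamma0 L) 2)} (hx : x ∈ periodHomology L) :
    Φ (Submodule.Quotient.mk ((2 : ℂ)⁻¹ • x)) + Φ (Submodule.Quotient.mk ((2 : ℂ)⁻¹ • x)) = 0 := by
  rw [← map_add, half_add_half_eq_zero hx, map_zero]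

/-- **(G4, Galois half) THE GALOIS PLANE AT A DEPLETED LEVEL, CARRIER-AGNOSTIC.** See the module docstring for the hypotheses. Conclusion: for every
`x ∈ Λ_L` and `P₁ ∈ W₁[2](ℚ̄)` with `Φ₁ [x/2] = ι P₁`, `Φ₂ [x/2] = ι (e P₁)` for THE `Γ_ℚ`-equivariant `e`.
[cite: DarmonDiamondTaylor1995, §1.5 and §1.7] [cite: Buzzard2000LevelLoweringModTwo, Prop. 2.4] -/
theorem half_transport_of_abstract
    (hSD : heckeSelfDual_torsionBy_J0) (hBz : buzzard2000_multiplicityOne_gamma0)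
    {W₁ W₂ : WeierstrassCurve ℚ} [W₁.IsElliptic] [W₁.IsGloballyMinimal] [W₂.IsElliptic]
    (ht₁ : ∀ x : ℚ, ¬ HasRationalTwoTorsionX W₁ x) (ht₂ : ∀ x : ℚ, ¬ HasRationalTwoTorsionX W₂ x)
    (hΔ₁ : ∀ s : ℚ_[2], s ^ 2 ≠ (W₁.Δ : ℚ_[2])) (hΔ₂ : ¬ IsSquare W₂.Δ)
    {N₁ : ℕ} [NeZero N₁] {f₁ : CuspForm (Gamma0 N₁) 2} (hf₁ : IsNewformOf W₁ f₁)
    (S : Finset ℕ) (hS : ∀ ℓ ∈ S, ℓ.Prime) (hL : Odd L) (hNL : N₁ * ∏ ℓ ∈ S, ℓ ^ 2 ∣ L)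
    (hLS : ∀ p : ℕ, p.Prime → p ∣ L → p ∈ S)
    (hgood₁ : ∀ v : HeightOneSpectrum (𝓞 ℚ), ¬ ((primesEquiv v : ℕ) ∣ 2 * L) → W₁.HasGoodReductionAt v)
    {F : Type*} [Field F] [Algebra ℚ F] [FiniteDimensional ℚ F] (hF : finrank ℚ F = 3)
    {r₁ r₂ : F} (hr₁ : aeval r₁ (twoDivisionUCubic W₁) = 0) (hr₂ : aeval r₂ (twoDivisionUCubic W₂) = 0)
    (Φ₁ : J0 L →+ (W₁.baseChange ℂ).toAffine.Point) (Φ₂ : J0 L →+ (W₂.baseChange ℂ).toAffine.Point)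
    (gal : Field.absoluteGaloisGroup ℚ → (J0.tors L →+ J0.tors L))
    (hgal₁ : ∀ (σ : Field.absoluteGaloisGroup ℚ) (y : J0.tors L) (P : W₁.geomPoints),
      Φ₁ (y : J0 L) = W₁.geomPointsToComplex ι P → Φ₁ ((gal σ y : J0.tors L) : J0 L) = W₁.geomPointsToComplex ι (σ • P))
    (hgal₂ : ∀ (σ : Field.absoluteGaloisGroup ℚ) (y : J0.tors L) (P : W₂.geomPoints),
      Φ₂ (y : J0 L) = W₂.geomPointsToComplex ι P → Φ₂ ((gal σ y : J0.tors L) : J0 L) = W₂.geomPointsToComplex ι (σ • P))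
    (hT₁ : ∀ (q : ℕ) (hq : q.Prime), ¬ q ∣ L → ∀ x ∈ periodHomology L,
      Φ₁ (Submodule.Quotient.mk ((2 : ℂ)⁻¹ •
        ((haveI : NeZero q := ⟨hq.ne_zero⟩; heckeT (Gamma0 L) 2 q).dualMap x - (W₁.LFunction q : ℂ) • x))) = 0)
    (hT₂ : ∀ (q : ℕ) (hq : q.Prime), ¬ q ∣ L → ∀ x ∈ periodHomology L,
      Φ₂ (Submodule.Quotient.mk ((2 : ℂ)⁻¹ •
        ((haveI : NeZero q := ⟨hq.ne_zero⟩; heckeT (Gamma0 L) 2 q).dualMap x - (W₁.LFunction q : ℂ) • x))) = 0)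
    (hU₁ : ∀ (q : ℕ) (hq : q.Prime), q ∣ L → ∀ x ∈ periodHomology L,
      Φ₁ (Submodule.Quotient.mk ((2 : ℂ)⁻¹ • (haveI : NeZero q := ⟨hq.ne_zero⟩; heckeT (Gamma0 L) 2 q).dualMap x)) = 0)
    (hU₂ : ∀ (q : ℕ) (hq : q.Prime), q ∣ L → ∀ x ∈ periodHomology L,
      Φ₂ (Submodule.Quotient.mk ((2 : ℂ)⁻¹ • (haveI : NeZero q := ⟨hq.ne_zero⟩; heckeT (Gamma0 L) 2 q).dualMap x)) = 0)
    (hnz₁ : ∃ x ∈ periodHomology L, Φ₁ (Submodule.Quotient.mk ((2 : ℂ)⁻¹ • x)) ≠ 0)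
    (hnz₂ : ∃ x ∈ periodHomology L, Φ₂ (Submodule.Quotient.mk ((2 : ℂ)⁻¹ • x)) ≠ 0)
    (e : geomTorsion W₁ (2 : ℤ) ≃+ geomTorsion W₂ (2 : ℤ))
    (he : ∀ (σ : Field.absoluteGaloisGroup ℚ) (P : geomTorsion W₁ (2 : ℤ)), e (σ • P) = σ • e P)
    {x : Module.Dual ℂ (CuspForm (Gamma0 L) 2)} (hx : x ∈ periodHomology L) {P₁ : geomTorsion W₁ (2 : ℤ)}
    (hP₁ : Φ₁ (Submodule.Quotient.mk ((2 : ℂ)⁻¹ • x)) = W₁.geomPointsToComplex ι (P₁ : W₁.geomPoints)) :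
    Φ₂ (Submodule.Quotient.mk ((2 : ℂ)⁻¹ • x)) = W₂.geomPointsToComplex ι ((e P₁ : geomTorsion W₂ (2 : ℤ)) : W₂.geomPoints) := by
  -- notation
  set Λ := periodHomology L with hΛ
  let half : Module.Dual ℂ (CuspForm (Gamma0 L) 2) → J0 L := fun z ↦ Submodule.Quotient.mk ((2 : ℂ)⁻¹ • z)
  have half_add : ∀ z z', half (z + z') = half z + half z' := fun z z' ↦ by
    simp only [half, smul_add, Submodule.Quotient.mk_add]
  -- the maps `θᵢ : Λ → Wᵢ[2]` through `existsUnique_geomTorsion_eq`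
  have hex₁ : ∀ z : Λ, ∃! P : geomTorsion W₁ (2 : ℤ), W₁.geomPointsToComplex ι (P : W₁.geomPoints) = Φ₁ (half z) :=
    fun z ↦ existsUnique_geomTorsion_eq W₁ ι (apply_half_add_self Φ₁ z.2)
  have hex₂ : ∀ z : Λ, ∃! P : geomTorsion W₂ (2 : ℤ), W₂.geomPointsToComplex ι (P : W₂.geomPoints) = Φ₂ (half z) :=
    fun z ↦ existsUnique_geomTorsion_eq W₂ ι (apply_half_add_self Φ₂ z.2)
  choose θ₁f hθ₁f using fun z ↦ (hex₁ z).exists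
  choose θ₂f hθ₂f using fun z ↦ (hex₂ z).exists
  have uniq₁ : ∀ (z : Λ) (P : geomTorsion W₁ (2 : ℤ)), W₁.geomPointsToComplex ι (P : W₁.geomPoints) = Φ₁ (half z) → P = θ₁f z :=
    fun z P hP ↦ (hex₁ z).unique hP (hθ₁f z)
  have uniq₂ : ∀ (z : Λ) (P : geomTorsion W₂ (2 : ℤ)), W₂.geomPointsToComplex ι (P : W₂.geomPoints) = Φ₂ (half z) → P = θ₂f z :=
    fun z P hP ↦ (hex₂ z).unique hP (hθ₂f z)
  let θ₁ : Λ →+ geomTorsion W₁ (2 : ℤ) :=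
    { toFun := θ₁f
      map_zero' := by
        symm; apply uniq₁
        have h0 : half 0 = 0 := by simp only [half, smul_zero, Submodule.Quotient.mk_zero]
        rw [ZeroMemClass.coe_zero, map_zero, ZeroMemClass.coe_zero, h0, map_zero]
      map_add' := fun z z' ↦ by
        symm; apply uniq₁
        rw [AddSubgroup.coe_add, map_add, hθ₁f, hθ₁f, AddSubgroup.coe_add, half_add, map_add] }
  let θ₂ : Λ →+ geomTorsion W₂ (2 : ℤ) :=
    { toFun := θ₂f
      map_zero' := by
        symm; apply uniq₂
        have h0 : half 0 = 0 := by simp only [half, smul_zero, Submodule.Quotient.mk_zero]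
        rw [ZeroMemClass.coe_zero, map_zero, ZeroMemClass.coe_zero, h0, map_zero]
      map_add' := fun z z' ↦ by
        symm; apply uniq₂
        rw [AddSubgroup.coe_add, map_add, hθ₂f, hθ₂f, AddSubgroup.coe_add, half_add, map_add] }
  have hθ₁_apply : ∀ z, θ₁ z = θ₁f z := fun _ ↦ rfl
  have hθ₂_apply : ∀ z, θ₂ z = θ₂f z := fun _ ↦ rfl
  -- the torsion points `⟨half z⟩ ∈ J0.tors L` and the lifted Galois action on `Λ`
  have htors : ∀ z : Λ, half z ∈ J0.tors L := fun z ↦ by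
    rw [J0.mem_tors_iff, isOfFinAddOrder_iff_nsmul_eq_zero]
    exact ⟨2, two_pos, by rw [two_nsmul]; exact half_add_half_eq_zero z.2⟩
  have hlift : ∀ (σ : Field.absoluteGaloisGroup ℚ) (z : Λ), ∃ z' : Λ,
      half z' = ((gal σ ⟨half z, htors z⟩ : J0.tors L) : J0 L) := by
    intro σ z
    set t : J0.tors L := gal σ ⟨half z, htors z⟩ with ht
    have htt : (t : J0 L) + (t : J0 L) = 0 := by
      rw [← Submodule.coe_add, ht, ← map_add]
      have : (⟨half z, htors z⟩ : J0.tors L) + ⟨half z, htors z⟩ = 0 := Subtype.ext (half_add_half_eq_zero z.2)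
      rw [this, map_zero, Submodule.coe_zero]
    obtain ⟨z', hz', hz'eq⟩ := exists_half_eq htt
    exact ⟨⟨z', hz'⟩, hz'eq⟩
  choose act hact using hlift
  -- equivariance
  have hθ₁ : ∀ (σ : Field.absoluteGaloisGroup ℚ) (z : Λ), θ₁ (act σ z) = σ • θ₁ z := by
    intro σ z
    symm
    rw [hθ₁_apply, hθ₁_apply]
    apply uniq₁
    rw [AddSubgroup.torsionBy.coe_smul, hact σ z]
    exact (hgal₁ σ ⟨half z, htors z⟩ (θ₁f z : W₁.geomPoints) (hθ₁f z).symm).symm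
  have hθ₂ : ∀ (σ : Field.absoluteGaloisGroup ℚ) (z : Λ), θ₂ (act σ z) = σ • θ₂ z := by
    intro σ z
    symm
    rw [hθ₂_apply, hθ₂_apply]
    apply uniq₂
    rw [AddSubgroup.torsionBy.coe_smul, hact σ z]
    exact (hgal₂ σ ⟨half z, htors z⟩ (θ₂f z : W₂.geomPoints) (hθ₂f z).symm).symm
  -- non-vanishing
  have h0 : ∀ {W' : WeierstrassCurve ℚ} [W'.IsElliptic] (Φ' : J0 L →+ (W'.baseChange ℂ).toAffine.Point)
      (θf : Λ → geomTorsion W' (2 : ℤ))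
      (hθf : ∀ z, W'.geomPointsToComplex ι (θf z : W'.geomPoints) = Φ' (half z))
      (hnz : ∃ z ∈ periodHomology L, Φ' (Submodule.Quotient.mk ((2 : ℂ)⁻¹ • z)) ≠ 0), ∃ z, θf z ≠ 0 := by
    intro W' _ Φ' θf hθf hnz
    obtain ⟨z, hz, hne⟩ := hnz
    refine ⟨⟨z, hz⟩, fun h0 ↦ hne ?_⟩
    have := hθf ⟨z, hz⟩
    rw [h0, ZeroMemClass.coe_zero, map_zero] at this
    exact this.symm
  have h0₁ : ∃ z, θ₁ z ≠ 0 := h0 Φ₁ θ₁f hθ₁f hnz₁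
  have h0₂ : ∃ z, θ₂ z ≠ 0 := h0 Φ₂ θ₂f hθ₂f hnz₂
  -- the common kernel `K` and its index bound
  set K : AddSubgroup Λ := θ₁.ker ⊓ θ₂.ker with hK
  have hmemK : ∀ (z : Module.Dual ℂ (CuspForm (Gamma0 L) 2)) (hz : z ∈ Λ),
      Φ₁ (half z) = 0 → Φ₂ (half z) = 0 → (⟨z, hz⟩ : Λ) ∈ K := by
    intro z hz h1 h2
    refine AddSubgroup.mem_inf.mpr ⟨?_, ?_⟩
    · rw [AddMonoidHom.mem_ker, hθ₁_apply]; symm; apply uniq₁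
      rw [ZeroMemClass.coe_zero, map_zero]; exact h1.symm
    · rw [AddMonoidHom.mem_ker, hθ₂_apply]; symm; apply uniq₂
      rw [ZeroMemClass.coe_zero, map_zero]; exact h2.symm
  set KΛ : AddSubgroup (Module.Dual ℂ (CuspForm (Gamma0 L) 2)) := K.map Λ.subtype with hKΛ
  have hKΛmem : ∀ (z : Module.Dual ℂ (CuspForm (Gamma0 L) 2)) (hz : z ∈ Λ), (⟨z, hz⟩ : Λ) ∈ K → z ∈ KΛ :=
    fun z hz h ↦ ⟨⟨z, hz⟩, h, rfl⟩
  have h2K : ∀ z ∈ periodHomology L, (2 : ℂ) • z ∈ KΛ := by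
    intro z hz
    have h2z : (2 : ℂ) • z ∈ Λ := by
      have := Λ.nsmul_mem hz 2
      rwa [← Nat.cast_smul_eq_nsmul ℂ, Nat.cast_ofNat] at this
    have hhalf : half ((2 : ℂ) • z) = 0 := by
      simp only [half, smul_smul, inv_mul_cancel₀ (two_ne_zero : (2 : ℂ) ≠ 0), one_smul]
      rw [Submodule.Quotient.mk_eq_zero, mem_periodHomologyHecke]; exact hz
    exact hKΛmem _ h2z (hmemK _ h2z (by rw [hhalf, map_zero]) (by rw [hhalf, map_zero]))
  have hTK : ∀ (q : ℕ) (hq : q.Prime), ¬ q ∣ L → ∀ z ∈ periodHomology L,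
      (haveI : NeZero q := ⟨hq.ne_zero⟩; heckeT (Gamma0 L) 2 q).dualMap z - (W₁.LFunction q : ℂ) • z ∈ KΛ := by
    intro q hq hqL z hz
    haveI : NeZero q := ⟨hq.ne_zero⟩
    have hmemΛ : (heckeT (Gamma0 L) 2 q).dualMap z - (W₁.LFunction q : ℂ) • z ∈ Λ := by
      refine Λ.sub_mem (dualMap_heckeT_mem_periodHomology L hq hz) ?_
      have := Λ.zsmul_mem hz (W₁.LFunction q)
      rwa [← Int.cast_smul_eq_zsmul ℂ] at this
    exact hKΛmem _ hmemΛ (hmemK _ hmemΛ (hT₁ q hq hqL z hz) (hT₂ q hq hqL z hz))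
  have hUK : ∀ (q : ℕ) (hq : q.Prime), q ∣ L → ∀ z ∈ periodHomology L,
      (haveI : NeZero q := ⟨hq.ne_zero⟩; heckeT (Gamma0 L) 2 q).dualMap z ∈ KΛ := by
    intro q hq hqL z hz
    haveI : NeZero q := ⟨hq.ne_zero⟩
    have hmemΛ : (heckeT (Gamma0 L) 2 q).dualMap z ∈ Λ := dualMap_heckeT_mem_periodHomology L hq hz
    exact hKΛmem _ hmemΛ (hmemK _ hmemΛ (hU₁ q hq hqL z hz) (hU₂ q hq hqL z hz))
  obtain ⟨v₁, hv₁, v₂, hv₂, hcos⟩ :=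
    fourCosets_of_dvd_S3 hSD hBz W₁ ht₁ hΔ₁ hf₁ S hS L hL hNL hLS hgood₁ KΛ h2K hTK hUK
  have hidx := index_addSubgroupOf_le_four (periodHomology L) KΛ hv₁ hv₂ hcos
  have hKeq : KΛ.addSubgroupOf Λ = K := by
    rw [hKΛ, AddSubgroup.addSubgroupOf, AddSubgroup.comap_map_eq_self_of_injective]
    exact Subtype.val_injective
  rw [hKeq] at hidx
  -- the factorisation through THE equivariant isomorphism
  have hcomp := comp_eq_of_sharedCubicField (W₁ := W₁) (W₂ := W₂) hF ht₁ ht₂ hΔ₂ hr₁ hr₂ act θ₁ θ₂ hθ₁ hθ₂ h0₁ h0₂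
    K inf_le_left inf_le_right hidx.1 hidx.2 e he
  -- conclude at `x`
  have hP₁' : P₁ = θ₁f ⟨x, hx⟩ := uniq₁ ⟨x, hx⟩ P₁ hP₁.symm
  have := hθ₂f ⟨x, hx⟩
  rw [← hθ₂_apply, hcomp ⟨x, hx⟩, hθ₁_apply, ← hP₁'] at this
  exact this.symm

/-- **(G4, Galois half) in link currency.** Under the hypotheses of `half_transport_of_abstract` and with the maps `Φᵢ` reading on half-classes as
`Φᵢ [x/2] = uᵢ(cᵢ·D_S·x(gᵢ)/2)` for parametrisation data `Dᵢ` and depleted forms `gᵢ` (hypotheses `hΦ₁ hΦ₂`, the shape of the future carrier's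
`jacobiMap_mk`), every `x ∈ Λ_L` carries the link `∃ P, ι P = u₁(c₁·D_S·x(g₁)/2) ∧ ι (e P) = u₂(c₂·D_S·x(g₂)/2)` — the hypothesis `hlink` of
`…DeltaPosParityLinkDepleted.even_depletedPlusValue_iff_of_link`. [cite: DarmonDiamondTaylor1995, §1.5 and §1.7]
[cite: Buzzard2000LevelLoweringModTwo, Prop. 2.4] -/
theorem half_transport_link
    (hSD : heckeSelfDual_torsionBy_J0) (hBz : buzzard2000_multiplicityOne_gamma0)
    {W₁ W₂ : WeierstrassCurve ℚ} [W₁.IsElliptic] [W₁.IsGloballyMinimal] [W₂.IsElliptic]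
    (ht₁ : ∀ x : ℚ, ¬ HasRationalTwoTorsionX W₁ x) (ht₂ : ∀ x : ℚ, ¬ HasRationalTwoTorsionX W₂ x)
    (hΔ₁ : ∀ s : ℚ_[2], s ^ 2 ≠ (W₁.Δ : ℚ_[2])) (hΔ₂ : ¬ IsSquare W₂.Δ)
    {N₁ N₂ : ℕ} [NeZero N₁] [NeZero N₂] (D₁ : ModularParametrizationData W₁ N₁) (D₂ : ModularParametrizationData W₂ N₂)
    (S : Finset ℕ) (hS : ∀ ℓ ∈ S, ℓ.Prime) (hL : Odd L) (hNL : N₁ * ∏ ℓ ∈ S, ℓ ^ 2 ∣ L)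
    (hLS : ∀ p : ℕ, p.Prime → p ∣ L → p ∈ S)
    (hgood₁ : ∀ v : HeightOneSpectrum (𝓞 ℚ), ¬ ((primesEquiv v : ℕ) ∣ 2 * L) → W₁.HasGoodReductionAt v)
    {F : Type*} [Field F] [Algebra ℚ F] [FiniteDimensional ℚ F] (hF : finrank ℚ F = 3)
    {r₁ r₂ : F} (hr₁ : aeval r₁ (twoDivisionUCubic W₁) = 0) (hr₂ : aeval r₂ (twoDivisionUCubic W₂) = 0)
    (g₁ g₂ : CuspForm (Gamma0 L) 2)
    (Φ₁ : J0 L →+ (W₁.baseChange ℂ).toAffine.Point) (Φ₂ : J0 L →+ (W₂.baseChange ℂ).toAffine.Point)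
    (hΦ₁ : ∀ x ∈ periodHomology L, Φ₁ (Submodule.Quotient.mk ((2 : ℂ)⁻¹ • x)) =
      D₁.uniformize ((D₁.c : ℂ) * (((∏ ℓ ∈ S, ℓ ^ 2 : ℕ) : ℂ) * x g₁) / 2))
    (hΦ₂ : ∀ x ∈ periodHomology L, Φ₂ (Submodule.Quotient.mk ((2 : ℂ)⁻¹ • x)) =
      D₂.uniformize ((D₂.c : ℂ) * (((∏ ℓ ∈ S, ℓ ^ 2 : ℕ) : ℂ) * x g₂) / 2))
    (gal : Field.absoluteGaloisGroup ℚ → (J0.tors L →+ J0.tors L))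
    (hgal₁ : ∀ (σ : Field.absoluteGaloisGroup ℚ) (y : J0.tors L) (P : W₁.geomPoints),
      Φ₁ (y : J0 L) = W₁.geomPointsToComplex ι P → Φ₁ ((gal σ y : J0.tors L) : J0 L) = W₁.geomPointsToComplex ι (σ • P))
    (hgal₂ : ∀ (σ : Field.absoluteGaloisGroup ℚ) (y : J0.tors L) (P : W₂.geomPoints),
      Φ₂ (y : J0 L) = W₂.geomPointsToComplex ι P → Φ₂ ((gal σ y : J0.tors L) : J0 L) = W₂.geomPointsToComplex ι (σ • P))
    (hT₁ : ∀ (q : ℕ) (hq : q.Prime), ¬ q ∣ L → ∀ x ∈ periodHomology L,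
      Φ₁ (Submodule.Quotient.mk ((2 : ℂ)⁻¹ •
        ((haveI : NeZero q := ⟨hq.ne_zero⟩; heckeT (Gamma0 L) 2 q).dualMap x - (W₁.LFunction q : ℂ) • x))) = 0)
    (hT₂ : ∀ (q : ℕ) (hq : q.Prime), ¬ q ∣ L → ∀ x ∈ periodHomology L,
      Φ₂ (Submodule.Quotient.mk ((2 : ℂ)⁻¹ •
        ((haveI : NeZero q := ⟨hq.ne_zero⟩; heckeT (Gamma0 L) 2 q).dualMap x - (W₁.LFunction q : ℂ) • x))) = 0)
    (hU₁ : ∀ (q : ℕ) (hq : q.Prime), q ∣ L → ∀ x ∈ periodHomology L,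
      Φ₁ (Submodule.Quotient.mk ((2 : ℂ)⁻¹ • (haveI : NeZero q := ⟨hq.ne_zero⟩; heckeT (Gamma0 L) 2 q).dualMap x)) = 0)
    (hU₂ : ∀ (q : ℕ) (hq : q.Prime), q ∣ L → ∀ x ∈ periodHomology L,
      Φ₂ (Submodule.Quotient.mk ((2 : ℂ)⁻¹ • (haveI : NeZero q := ⟨hq.ne_zero⟩; heckeT (Gamma0 L) 2 q).dualMap x)) = 0)
    (hnz₁ : ∃ x ∈ periodHomology L, Φ₁ (Submodule.Quotient.mk ((2 : ℂ)⁻¹ • x)) ≠ 0)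
    (hnz₂ : ∃ x ∈ periodHomology L, Φ₂ (Submodule.Quotient.mk ((2 : ℂ)⁻¹ • x)) ≠ 0)
    (e : geomTorsion W₁ (2 : ℤ) ≃+ geomTorsion W₂ (2 : ℤ))
    (he : ∀ (σ : Field.absoluteGaloisGroup ℚ) (P : geomTorsion W₁ (2 : ℤ)), e (σ • P) = σ • e P)
    {x : Module.Dual ℂ (CuspForm (Gamma0 L) 2)} (hx : x ∈ periodHomology L) :
    ∃ P : geomTorsion W₁ (2 : ℤ),
      W₁.geomPointsToComplex ι (P : geomPoints W₁) = D₁.uniformize ((D₁.c : ℂ) * (((∏ ℓ ∈ S, ℓ ^ 2 : ℕ) : ℂ) * x g₁) / 2) ∧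
      W₂.geomPointsToComplex ι (e P : geomPoints W₂) = D₂.uniformize ((D₂.c : ℂ) * (((∏ ℓ ∈ S, ℓ ^ 2 : ℕ) : ℂ) * x g₂) / 2) := by
  obtain ⟨P₁, hP₁, -⟩ := existsUnique_geomTorsion_eq W₁ ι (apply_half_add_self Φ₁ hx)
  refine ⟨P₁, by rw [hP₁, hΦ₁ x hx], ?_⟩
  rw [← hΦ₂ x hx]
  exact (half_transport_of_abstract ι hSD hBz ht₁ ht₂ hΔ₁ hΔ₂ D₁.isNewformOf S hS hL hNL hLS hgood₁ hF hr₁ hr₂ Φ₁ Φ₂ gal hgal₁ hgal₂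
    hT₁ hT₂ hU₁ hU₂ hnz₁ hnz₂ e he hx hP₁.symm).symm

end Transport

end Summit.BirchSwinnertonDyer.BirchSwinnertonDyer.Theorems.AlignedTransportAtTwoDeltaPosJacobianLevel

end
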